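/-
Copyright (c) 2026 the pub-hodgecm-mathlib formalisation cell (harness21).  Prover seat hodgecm-mathlib-K2Liu-p09 (g4): Track B «K2-LIT», #184♮ = hLiu418,
Road I organ (A-int)-fin, brick (β-3) «the implementer `Γ_v` and the comparison of the two local models» (K2E5-plan (g5) RULING (β) 07:08:32Z;
heads `K2/K2Liu-p09/g4/HEADS-DAprime-beta3.K2Liu-p09-g4.md`).
-/
import Summits.HodgeConjecture.HodgeConjecture.Theorems.K2LiuDoublingSchrodingerModelDefs   -- (β-1) ★ p858244
import Summits.HodgeConjecture.HodgeConjecture.Theorems.K2LiuLocalSWSectionDefs              -- D-A v1 ★ p858139 (`swSectionLoc v s m₀`)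
import Literature.RepresentationTheory.HeisenbergGroup.DoubledDeltaInvariantFunctional      -- ★ Γ = Frobenius ∕ partial Fourier in the sum variable; uniqueness
import Literature.NumberTheory.GelbartRogawski1991.LocalDoubledDeltaFunctionalEquivariance -- ★ `Δ`-equivariance of `Φ ↦ (ω(m₀)Φ)(0)`
import Literature.NumberTheory.GelbartRogawski1991.DoubledWeilRepresentationLocalFamilyCM    -- ★ `isUnit_det_gramR₀`, `deltaLoc`, `map_deltaLoc_deltaLagrangian` (the `m₀` of record)
import HarnessLib

/-!
# Crux `HLiu418`, Track B road `K2_Liu`, Road I organ (A-int)-fin — brick (β-3): THE IMPLEMENTER `Γ_v` (Frobenius map into the `ℓ_Δ`-model =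
# partial Fourier transform in the sum variable), the doubling Siegel–Weil section as the DIAGONAL INTEGRAL, and the comparison with the CM-model section

Cell `hodgecm-mathlib`, crux item hLiu418 = `stmt-HodgeConjecture-24832`, route of record `HCCMUnconditional`; squad K2 ∕ K2Liu, prover K2Liu-p09 (g4);
KERNEL lane (theorems only; no `def`, no instance, no notation, no named-fact hypothesis, no `sorry`), `--supports stmt-HodgeConjecture-24832 --as helper`.

Setting of ★ (β-1) `K2LiuDoublingSchrodingerModelDefs`: a doubled CM datum `(L, e, dV, dW)` (here with non-zero diagonal entries `hdV0`, `hdW0`), a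
finite place `v` of `L⁺`, the CM∕real-part model `ρ_v = localSchrodinger L⁺ (n+n) (gramD …) v` and the doubling-polarised model
`ρ^Δ_v = localSchrodingerDelta … v` on `𝒮(L⁺_v^{n+n})`, the transports `Φ_Δ = deltaHeisenbergEquivLoc`, `mpTransportLoc Γ`, the sections
`swSectionDelta` (Δ-model, evaluation at `0`) and ★ D-A v1 `swSectionLoc v s m₀` (CM model, `(ω(m₀ s h) Φ)(0)`); an additive Haar measure `μ` on `L⁺_v^n`.
* §1 `isUnit_det_gramRLoc` (`det T₀,v` is a unit).
* §2 **`exists_isDeltaIntertwiner_apply_zero`** — THE IMPLEMENTER EXISTS, EXPLICITLY: `∃ Γ, IsDeltaIntertwiner v Γ ∧ ∀ Φ, (Γ Φ)(0) = ∫ Φ(u ⊔ u) dμ(u)`; `Γ` is the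
  ★ Frobenius map into the `ℓ_Δ`-model (`DoubledDeltaInvariantFunctional.exists_deltaFrobeniusEquiv`) = the partial Fourier transform in the sum variable
  for `2T₀,v` (★ `coe_deltaFrobenius_eq_partialFourierSum`); it intertwines by ★ `equiv_schrodingerSB_of_coe_eq_deltaFrobenius` and its value at `0` is the
  diagonal integral by ★ `frobeniusToSchrodinger_apply_zero`.  No existence-only Stone–von Neumann step.
* §3 **`swSectionDelta_transport_eq_diagIntegral`** — for any such `Γ` and any CM-model splitting `s`, the doubling Siegel–Weil section of `Γ Φ` in the
  Δ-model along the transported splitting `Γ_* s = mpTransportLoc Γ ∘ s` is the DIAGONAL INTEGRAL of the CM-model Weil translate: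
  `f^Δ_{Γ Φ}(h) = ∫ (ω_s(h) Φ)(u ⊔ u) dμ(u)`.
* §4 **`exists_swSectionLoc_eq_mul_swSectionDelta`** — COMPARISON WITH D-A v1: for `m₀ ∈ S̃p_ψ(𝕎_v)` whose projection carries `ℓ_Δ` onto `ℓ_Y` (GR91's
  `hm₀` verbatim), ONE constant `c` (the same for all `(s, Φ, h)`) with `swSectionLoc v s m₀ Φ h = c · f^Δ_{Γ Φ}(h)` (uniqueness of the `ℓ_Δ`-invariant
  functional ★ `exists_eq_mul_diagIntegral_of_forall_deltaW` + ★ `apply_zero_toRep_schrodinger_of_mem_deltaLagrangian`).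
* §4′ **the `m₀` OF RECORD** (rider (R1)): `…_of_proj_eq_deltaLoc` — `hm₀` discharged for ANY lift of ★ `deltaLoc v` (★ `map_deltaLoc_deltaLagrangian`); `…_of_record` —
  the pair `(deltaLoc v, r (deltaLoc v))` for any implementer section `r` (operator = ★ `rDeltaAt 𝓓 = (𝓓 v).r (deltaLoc v)`, the `M_δ` every consumer's section uses).

HONEST LABEL: HC_CM is proved only modulo the printed citations (2 remaining named inputs: hLiu418 = stmt-HodgeConjecture-24832,
h413 = stmt-HodgeConjecture-24833) until rung 0 closes; count-neutral helper, closes no item.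
References: [MoeglinVignerasWaldspurger1987] Chap. 2 I.3, I.7, II.1, II.6; [Kudla1994] §2, §3 Thm. 3.1; [KudlaRallis1994] §1; [HarrisKudlaSweet1996] §1 (1.9)–(1.11);
[GelbartRogawski1991] §3.1.
-/

set_option autoImplicit false
set_option linter.dupNamespace false

noncomputable section

open scoped Matrix
open NumberField IsDedekindDomain MeasureTheory Matrix
open Literature.RepresentationTheory.HeisenbergGroup
open Literature.NumberTheory.Automorphic Literature.NumberTheory.Weil1964
open Literature.NumberTheory.GelbartRogawski1991 Literature.NumberTheory.GelbartRogawski1991.GRConstruction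
open Literature.NumberTheory.GelbartRogawski1991.UnitaryDualPair.LocalSplitting
open Summit.HodgeConjecture.HodgeConjecture.Cruxes.HLiu418.K2LiuDoublingSchrodingerModelDefs
open Summit.HodgeConjecture.HodgeConjecture.Cruxes.HLiu418.K2LiuLocalSWSectionDefs

namespace Summit.HodgeConjecture.HodgeConjecture.Cruxes.HLiu418.K2LiuDoublingModelComparison

variable (L : Type) [Field L] [NumberField L] [IsCMField L]
variable {N M n : ℕ} (e : Fin N × Fin M ≃ Fin n)
  (dV : Fin N → L) (hdV : ∀ i, IsCMField.complexConj L (dV i) = dV i) (hdV0 : ∀ i, dV i ≠ 0)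
  (dW : Fin M → L) (hdW : ∀ i, IsCMField.complexConj L (dW i) = dW i) (hdW0 : ∀ i, dW i ≠ 0)
  (v : HeightOneSpectrum (𝓞 (Fp L)))
  [MeasurableSpace (Fin n → v.adicCompletion (Fp L))] [BorelSpace (Fin n → v.adicCompletion (Fp L))]
  (μ : Measure (Fin n → v.adicCompletion (Fp L))) [μ.IsAddHaarMeasure]

/-! ## §1 The local undoubled Gram matrix is invertible -/

omit [MeasurableSpace (Fin n → v.adicCompletion (Fp L))] [BorelSpace (Fin n → v.adicCompletion (Fp L))] in
include hdV0 hdW0 in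
/-- `det T₀,v` is a unit (★ `isUnit_det_gramR₀` through `L⁺ → L⁺_v`). [cite: GelbartRogawski1991, §3.1 Prop. 3.1.1 p. 455] -/
theorem isUnit_det_gramRLoc : IsUnit (gramRLoc L e dV hdV dW hdW v).det := by
  unfold gramRLoc
  rw [← RingHom.mapMatrix_apply, ← RingHom.map_det]
  exact (isUnit_det_gramR₀ L e dV hdV hdV0 dW hdW hdW0).map _

/-! ## §2 The implementer `Γ_v` exists, explicitly, with `(Γ Φ)(0) = ∫ Φ(u ⊔ u) dμ(u)` -/

include hdV0 hdW0 in
/-- **THE IMPLEMENTER OF THE CHANGE OF POLARISATION EXISTS, EXPLICITLY**: there is `Γ : 𝒮(L⁺_v^{n+n}) ≃ₗ[ℂ] 𝒮(L⁺_v^{n+n})` with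
`Γ (ρ_v(h) Φ) = ρ^Δ_v(Φ_Δ h) (Γ Φ)` ((β-1) `IsDeltaIntertwiner`) AND `(Γ Φ)(0) = diagIntegral e₂ μ Φ = ∫ Φ(u ⊔ u) dμ(u)` — `Γ` is the Frobenius map into the
`ℓ_Δ`-model, i.e. the partial Fourier transform in the sum variable for `2T₀,v` (★ `exists_deltaFrobeniusEquiv`, ★ `equiv_schrodingerSB_of_coe_eq_deltaFrobenius`,
★ `frobeniusToSchrodinger_apply_zero`). [cite: MoeglinVignerasWaldspurger1987, Chap. 2 I.3, I.7] [cite: Kudla1994, §2] -/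
theorem exists_isDeltaIntertwiner_apply_zero :
    ∃ Γ : SchwartzBruhat (Fin (n + n) → v.adicCompletion (Fp L)) ≃ₗ[ℂ] SchwartzBruhat (Fin (n + n) → v.adicCompletion (Fp L)),
      IsDeltaIntertwiner L e dV hdV dW hdW v Γ ∧
        ∀ Φ : SchwartzBruhat (Fin (n + n) → v.adicCompletion (Fp L)),
          ((Γ Φ : SchwartzBruhat (Fin (n + n) → v.adicCompletion (Fp L))) : (Fin (n + n) → v.adicCompletion (Fp L)) → ℂ) 0 =
            diagIntegral (GRConstruction.e₂ (n := n)) μ Φ := by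
  obtain ⟨Γ, hΓ⟩ := exists_deltaFrobeniusEquiv (GRConstruction.e₂ (n := n)) (gramRLoc L e dV hdV dW hdW v) (localGram_gramD_eq L e dV hdV dW hdW v)
    (isLocallyConstant_of_isContinuousNontrivial (isContinuousNontrivial_adeleAddCharAt (Fp L) v))
    (K2LiuDoublingSchrodingerModelDefs.continuous_toLinearMap₂'_left L (localGram (Fp L) (n + n) (gramD L e dV hdV dW hdW) v)) μ
    (isContinuousNontrivial_adeleAddCharAt (Fp L) v) (isUnit_det_gramRLoc L e dV hdV hdV0 dW hdW hdW0 v)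
  refine ⟨Γ, fun h Φ => ?_, fun Φ => ?_⟩
  · exact equiv_schrodingerSB_of_coe_eq_deltaFrobenius (GRConstruction.e₂ (n := n)) (gramRLoc L e dV hdV dW hdW v) (localGram_gramD_eq L e dV hdV dW hdW v)
      _ _ μ (K2LiuDoublingSchrodingerModelDefs.continuous_toLinearMap₂'_left L (deltaGramLoc L e dV hdV dW hdW v)) Γ hΓ h Φ
  · rw [hΓ Φ, frobeniusToSchrodinger_apply_zero]

/-! ## §3 The doubling Siegel–Weil section in the Δ-model is the diagonal integral -/

/-- **`f^Δ_{Γ Φ}(h) = ∫ (ω_s(h) Φ)(u ⊔ u) dμ(u)`**: for any implementer `Γ` with `(Γ Ψ)(0) = diagIntegral e₂ μ Ψ` (§2) and any CM-model splitting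
`s : U(J)(L⁺_v) →* S̃p_ψ(𝕎_v)`, the Siegel–Weil section of `Γ Φ` in the doubling-polarised model along `Γ_* s` is the DIAGONAL INTEGRAL of the CM-model
Weil translate ((β-1) `swSectionDelta_transport_apply`). [cite: KudlaRallis1994, §1] [cite: Kudla1994, §3 Thm. 3.1] [cite: MoeglinVignerasWaldspurger1987, Chap. 2 I.7] -/
theorem swSectionDelta_transport_eq_diagIntegral {Nd : ℕ} {J : Matrix (Fin Nd) (Fin Nd) L}
    (Γ : SchwartzBruhat (Fin (n + n) → v.adicCompletion (Fp L)) ≃ₗ[ℂ] SchwartzBruhat (Fin (n + n) → v.adicCompletion (Fp L)))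
    (hΓ : IsDeltaIntertwiner L e dV hdV dW hdW v Γ)
    (hΓ0 : ∀ Ψ : SchwartzBruhat (Fin (n + n) → v.adicCompletion (Fp L)),
      ((Γ Ψ : SchwartzBruhat (Fin (n + n) → v.adicCompletion (Fp L))) : (Fin (n + n) → v.adicCompletion (Fp L)) → ℂ) 0 =
        diagIntegral (GRConstruction.e₂ (n := n)) μ Ψ)
    (s : UnitaryGroup.localPi L (IsCMField.complexConj L) Nd J v →* LocalMp (Fp L) (n + n) (gramD L e dV hdV dW hdW) v)
    (Φ : SchwartzBruhat (Fin (n + n) → v.adicCompletion (Fp L))) (h : UnitaryGroup.localPi L (IsCMField.complexConj L) Nd J v) :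
    swSectionDelta L e dV hdV dW hdW v ((mpTransportLoc L e dV hdV dW hdW v Γ hΓ).toMonoidHom.comp s) (Γ Φ) h =
      diagIntegral (GRConstruction.e₂ (n := n)) μ (MpPsi.toRep (localSchrodinger (Fp L) (n + n) (gramD L e dV hdV dW hdW) v) (s h) Φ) :=
  (swSectionDelta_transport_apply L e dV hdV dW hdW v Γ hΓ s Φ h).trans (hΓ0 _)

/-! ## §4 Comparison with the CM-model section of D-A v1: one constant per place -/

set_option maxHeartbeats 800000 in -- the metaplectic pair carrier `MpPsi (localSchrodinger …)` unfolds slowly (cf. ★ `K2LiuLocalSWSectionDefs`)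
include hdV0 hdW0 in
/-- **COMPARISON OF THE TWO LOCAL SIEGEL–WEIL SECTIONS**: let `m₀ ∈ S̃p_ψ(𝕎_v)` have projection carrying `ℓ_Δ` onto `ℓ_Y` (GR91's `hm₀`, e.g. Rao's `r(δ′)`),
and `Γ` be an implementer as in §2.  Then there is ONE constant `c ∈ ℂ`, the same for every splitting `s`, every `Φ` and every `h`, with
`swSectionLoc v s m₀ Φ h = c · f^Δ_{Γ Φ}(h)` — the CM-model functional `Ψ ↦ (ω(m₀)Ψ)(0)` is `ℓ_Δ`-invariant (★ `apply_zero_toRep_schrodinger_of_mem_deltaLagrangian`)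
hence a multiple of the diagonal integral (★ `exists_eq_mul_diagIntegral_of_forall_deltaW`, MVW II.6 uniqueness).
[cite: MoeglinVignerasWaldspurger1987, Chap. 2 II.6] [cite: Kudla1994, §2] [cite: KudlaRallis1994, §1] -/
theorem exists_swSectionLoc_eq_mul_swSectionDelta
    (m₀ : LocalMp (Fp L) (n + n) (gramD L e dV hdV dW hdW) v)
    (hm₀ : (deltaLagrangian (Fp L) v n).map
        (toLin (Fp L) v (MpPsi.proj (localSchrodinger (Fp L) (n + n) (gramD L e dV hdV dW hdW) v) m₀)) = lagrangianY (Fp L) (n + n) v)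
    (Γ : SchwartzBruhat (Fin (n + n) → v.adicCompletion (Fp L)) ≃ₗ[ℂ] SchwartzBruhat (Fin (n + n) → v.adicCompletion (Fp L)))
    (hΓ : IsDeltaIntertwiner L e dV hdV dW hdW v Γ)
    (hΓ0 : ∀ Ψ : SchwartzBruhat (Fin (n + n) → v.adicCompletion (Fp L)),
      ((Γ Ψ : SchwartzBruhat (Fin (n + n) → v.adicCompletion (Fp L))) : (Fin (n + n) → v.adicCompletion (Fp L)) → ℂ) 0 =
        diagIntegral (GRConstruction.e₂ (n := n)) μ Ψ) :
    ∃ c : ℂ, ∀ {J : Matrix (Fin (n + n)) (Fin (n + n)) L}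
      (s : UnitaryGroup.localPi L (IsCMField.complexConj L) (n + n) J v →* LocalMp (Fp L) (n + n) (gramD L e dV hdV dW hdW) v)
      (Φ : SchwartzBruhat (Fin (n + n) → v.adicCompletion (Fp L))) (h : UnitaryGroup.localPi L (IsCMField.complexConj L) (n + n) J v),
      swSectionLoc L v s m₀ Φ h = c * swSectionDelta L e dV hdV dW hdW v ((mpTransportLoc L e dV hdV dW hdW v Γ hΓ).toMonoidHom.comp s) (Γ Φ) h := by
  -- the CM-model `Δ`-functional `Ψ ↦ (ω(m₀) Ψ)(0)` as a linear functional
  let Λ : SchwartzBruhat (Fin (n + n) → v.adicCompletion (Fp L)) →ₗ[ℂ] ℂ :=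
    (LinearMap.proj (0 : Fin (n + n) → v.adicCompletion (Fp L))).comp
      ((SchwartzBruhat (Fin (n + n) → v.adicCompletion (Fp L))).subtype.comp
        (MpPsi.toRep (localSchrodinger (Fp L) (n + n) (gramD L e dV hdV dW hdW) v) m₀))
  have hΛ : ∀ Ψ, Λ Ψ = ((MpPsi.toRep (localSchrodinger (Fp L) (n + n) (gramD L e dV hdV dW hdW) v) m₀ Ψ :
      SchwartzBruhat (Fin (n + n) → v.adicCompletion (Fp L))) : (Fin (n + n) → v.adicCompletion (Fp L)) → ℂ) 0 := fun Ψ => rfl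
  -- it is `ℓ_Δ`-invariant
  have hinv : ∀ (α β : Fin n → v.adicCompletion (Fp L)) (Ψ : SchwartzBruhat (Fin (n + n) → v.adicCompletion (Fp L))),
      Λ (localSchrodinger (Fp L) (n + n) (gramD L e dV hdV dW hdW) v ⟨deltaW (GRConstruction.e₂ (n := n)) α β, 0⟩ Ψ) = Λ Ψ := by
    intro α β Ψ
    have hmem : (⟨deltaW (GRConstruction.e₂ (n := n)) α β, 0⟩ : Heisenberg (polar (localPairing (Fp L) (n + n) (gramD L e dV hdV dW hdW) v))).v ∈
        deltaLagrangian (Fp L) v n :=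
      fun i => ⟨by rw [deltaW_fst, glue_apply_inl, glue_apply_inr], by rw [deltaW_snd, glue_apply_inl, glue_apply_inr]⟩
    have h1 := apply_zero_toRep_schrodinger_of_mem_deltaLagrangian (Fp L) v n (gramR L e dV hdV dW hdW) m₀ hm₀
      ⟨deltaW (GRConstruction.e₂ (n := n)) α β, 0⟩ hmem Ψ
    simp only [AddChar.map_zero_eq_one, Circle.coe_one, one_mul] at h1
    rw [hΛ, hΛ]
    exact h1
  obtain ⟨c, hc⟩ := exists_eq_mul_diagIntegral_of_forall_deltaW (GRConstruction.e₂ (n := n)) (gramRLoc L e dV hdV dW hdW v)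
    (localGram_gramD_eq L e dV hdV dW hdW v) (isLocallyConstant_of_isContinuousNontrivial (isContinuousNontrivial_adeleAddCharAt (Fp L) v))
    (K2LiuDoublingSchrodingerModelDefs.continuous_toLinearMap₂'_left L (localGram (Fp L) (n + n) (gramD L e dV hdV dW hdW) v)) μ
    (isContinuousNontrivial_adeleAddCharAt (Fp L) v) (isUnit_det_gramRLoc L e dV hdV hdV0 dW hdW hdW0 v) Λ hinv
  refine ⟨c, fun s Φ h => ?_⟩
  have h2 : MpPsi.toRep (localSchrodinger (Fp L) (n + n) (gramD L e dV hdV dW hdW) v) (m₀ * s h) =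
      MpPsi.toRep (localSchrodinger (Fp L) (n + n) (gramD L e dV hdV dW hdW) v) m₀ *
        MpPsi.toRep (localSchrodinger (Fp L) (n + n) (gramD L e dV hdV dW hdW) v) (s h) :=
    MonoidHom.map_mul _ m₀ (s h)
  have h3 : swSectionLoc L v s m₀ Φ h = Λ (MpPsi.toRep (localSchrodinger (Fp L) (n + n) (gramD L e dV hdV dW hdW) v) (s h) Φ) :=
    congrArg (fun T : SchwartzBruhat (Fin (n + n) → v.adicCompletion (Fp L)) →ₗ[ℂ] SchwartzBruhat (Fin (n + n) → v.adicCompletion (Fp L)) => ((T Φ : SchwartzBruhat (Fin (n + n) → v.adicCompletion (Fp L))) : (Fin (n + n) → v.adicCompletion (Fp L)) → ℂ) 0) h2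
  rw [h3, hc, swSectionDelta_transport_eq_diagIntegral L e dV hdV dW hdW v μ Γ hΓ hΓ0]

/-! ## §4′ The `m₀` OF RECORD: any metaplectic lift of `δ_v = deltaLoc v` (rider (R1), K2E5-plan (g6) 07:28:31Z ∕ LEAD 07:29:34Z) -/

set_option maxHeartbeats 800000 in -- as §4
include hdV0 hdW0 in
/-- **§4 FOR THE `m₀` OF RECORD — `hm₀` DISCHARGED**: every consumer's local section descends from ★ `swSection`∕`swSectionTensor`, whose Weil operator at `v` is
`M_δ := (𝓓 v).r (deltaLoc v)` = ★ `rDeltaAt 𝓓` (`DoubledUnitaryGlobalSplittingData`; the `M_δ` of ★ `ParabolicNormalisedAt` ∕ `FinLocalFamily.parabolicNormalised`), a lift of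
the symplectic element ★ `deltaLoc v` (`δ ⊗ 1` read at `v`); for ANY `m₀ ∈ S̃p_ψ(𝕎_v)` projecting to `deltaLoc v` the hypothesis `hm₀` of §4 holds by ★ `map_deltaLoc_deltaLagrangian`
(`δ_v ℓ_Δ = ℓ_Y`, GR91's global use site `DoubledWeilRepresentationLocalFamilyCM.cmDatumAt`), so: ONE constant `c` with `swSectionLoc v s m₀ Φ h = c · f^Δ_{Γ Φ}(h)` for all `(s, Φ, h)`.
[cite: GelbartRogawski1991, §3.1 Prop. 3.1.1 p. 455 L1–2] [cite: MoeglinVignerasWaldspurger1987, Chap. 2 II.6] [cite: KudlaRallis1994, §1] -/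
theorem exists_swSectionLoc_eq_mul_swSectionDelta_of_proj_eq_deltaLoc
    (m₀ : LocalMp (Fp L) (n + n) (gramD L e dV hdV dW hdW) v)
    (hproj : MpPsi.proj (localSchrodinger (Fp L) (n + n) (gramD L e dV hdV dW hdW) v) m₀ = deltaLoc L e dV hdV hdV0 dW hdW hdW0 v)
    (Γ : SchwartzBruhat (Fin (n + n) → v.adicCompletion (Fp L)) ≃ₗ[ℂ] SchwartzBruhat (Fin (n + n) → v.adicCompletion (Fp L)))
    (hΓ : IsDeltaIntertwiner L e dV hdV dW hdW v Γ)
    (hΓ0 : ∀ Ψ : SchwartzBruhat (Fin (n + n) → v.adicCompletion (Fp L)), ((Γ Ψ : SchwartzBruhat (Fin (n + n) → v.adicCompletion (Fp L))) : (Fin (n + n) → v.adicCompletion (Fp L)) → ℂ) 0 = diagIntegral (GRConstruction.e₂ (n := n)) μ Ψ) :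
    ∃ c : ℂ, ∀ {J : Matrix (Fin (n + n)) (Fin (n + n)) L}
      (s : UnitaryGroup.localPi L (IsCMField.complexConj L) (n + n) J v →* LocalMp (Fp L) (n + n) (gramD L e dV hdV dW hdW) v)
      (Φ : SchwartzBruhat (Fin (n + n) → v.adicCompletion (Fp L))) (h : UnitaryGroup.localPi L (IsCMField.complexConj L) (n + n) J v),
      swSectionLoc L v s m₀ Φ h = c * swSectionDelta L e dV hdV dW hdW v ((mpTransportLoc L e dV hdV dW hdW v Γ hΓ).toMonoidHom.comp s) (Γ Φ) h :=
  exists_swSectionLoc_eq_mul_swSectionDelta L e dV hdV hdV0 dW hdW hdW0 v μ m₀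
    (by rw [hproj]; exact map_deltaLoc_deltaLagrangian L e dV hdV hdV0 dW hdW hdW0 v) Γ hΓ hΓ0

set_option maxHeartbeats 800000 in -- as §4
include hdV0 hdW0 in
/-- **THE RECORD INSTANCE**: for ANY implementer section `r` of the CM model (e.g. `(𝓓 v).r` of ★ `localSplittingDatumCM` ∕ ★ `LocalDatumAt`), the pair
`m₀ := (deltaLoc v, r (deltaLoc v)) ∈ S̃p_ψ(𝕎_v)` (★ `ImplementerSection.mem_MpPsi`; its operator is ★ `rDeltaAt 𝓓 = (𝓓 v).r (deltaLoc v)`, the `M_δ` of record) satisfies §4 with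
`hm₀` gone: `∃ c, ∀ s Φ h, swSectionLoc v s m₀ Φ h = c · f^Δ_{Γ Φ}(h)`. [cite: GelbartRogawski1991, §3.1 Prop. 3.1.1 p. 455 L1–2] [cite: MoeglinVignerasWaldspurger1987, Chap. 2 II.1 (A), II.6] -/
theorem exists_swSectionLoc_eq_mul_swSectionDelta_of_record
    (r : ImplementerSection (localSchrodinger (Fp L) (n + n) (gramD L e dV hdV dW hdW) v))
    (Γ : SchwartzBruhat (Fin (n + n) → v.adicCompletion (Fp L)) ≃ₗ[ℂ] SchwartzBruhat (Fin (n + n) → v.adicCompletion (Fp L)))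
    (hΓ : IsDeltaIntertwiner L e dV hdV dW hdW v Γ)
    (hΓ0 : ∀ Ψ : SchwartzBruhat (Fin (n + n) → v.adicCompletion (Fp L)), ((Γ Ψ : SchwartzBruhat (Fin (n + n) → v.adicCompletion (Fp L))) : (Fin (n + n) → v.adicCompletion (Fp L)) → ℂ) 0 = diagIntegral (GRConstruction.e₂ (n := n)) μ Ψ) :
    ∃ c : ℂ, ∀ {J : Matrix (Fin (n + n)) (Fin (n + n)) L}
      (s : UnitaryGroup.localPi L (IsCMField.complexConj L) (n + n) J v →* LocalMp (Fp L) (n + n) (gramD L e dV hdV dW hdW) v)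
      (Φ : SchwartzBruhat (Fin (n + n) → v.adicCompletion (Fp L))) (h : UnitaryGroup.localPi L (IsCMField.complexConj L) (n + n) J v),
      swSectionLoc L v s ⟨(deltaLoc L e dV hdV hdV0 dW hdW hdW0 v, r (deltaLoc L e dV hdV hdV0 dW hdW hdW0 v)),
          ImplementerSection.mem_MpPsi r (deltaLoc L e dV hdV hdV0 dW hdW hdW0 v)⟩ Φ h =
        c * swSectionDelta L e dV hdV dW hdW v ((mpTransportLoc L e dV hdV dW hdW v Γ hΓ).toMonoidHom.comp s) (Γ Φ) h :=
  exists_swSectionLoc_eq_mul_swSectionDelta_of_proj_eq_deltaLoc L e dV hdV hdV0 dW hdW hdW0 v μ _ rfl Γ hΓ hΓ0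

end Summit.HodgeConjecture.HodgeConjecture.Cruxes.HLiu418.K2LiuDoublingModelComparison

end
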